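import Summits.HodgeConjecture.HodgeConjecture.Theses.AmpleAdicLefschetz
import Summits.HodgeConjecture.HodgeConjecture.Theorems.AmpleAdicLefschetzSectionalSourceStubSupply
import Summits.HodgeConjecture.HodgeConjecture.Theorems.AmpleAdicLefschetzSectionalSourceStubLowDegree
import Summits.HodgeConjecture.HodgeConjecture.Theorems.AmpleAdicLefschetzSectionalSourceStubIteratedSupply
import Literature.AlgebraicGeometry.HodgeTheory.MiddleHodgeOfAffineComplementSections
import Literature.AlgebraicGeometry.HodgeTheory.MiddleDimensionReductionHolds
import Literature.AlgebraicGeometry.HodgeTheory.HodgeTypePullback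
import Literature.AlgebraicGeometry.HodgeTheory.ComplexConjugationHolds
import HarnessLib

/-!
# Route AmpleAdicLefschetz — the crux `SectionalSource` is EQUIVALENT to the Hodge conjecture
(helpers `--supports` item stmt-HodgeConjecture-10725)

The crux `SectionalSource` (SS, rev 3, proper-section form) of the route `AmpleAdicLefschetz`: every
rational `(p,p)`-class on a smooth projective complex `n`-fold `X` with `2p + 1 ≤ n` becomes algebraic
on SOME admissible proper section (`Y` smooth projective, `f : Y ⟶ X` a closed immersion, `X ∖ f(Y)`
non-empty and covered by `≤ n − 2p` affine opens of `X`). This file records, sorry-free and on the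
tree's real carriers, that SS is equivalent to the summit statement `HodgeConjecture` itself:

* `ampleAdicLefschetz_hodgeMiddle_of_sectionalSource` — SS ⇒ the Hodge conjecture in the MIDDLE
  degree of every smooth projective `2p`-fold (THICK-free): the product trick `X := X₀ × ℙ¹`,
  `c := pr₁^* c₀`, SS at the slice `(2p + 1, p)` forcing ONE affine complement piece, dominance of such
  sections over `X₀` and the degree trick — the tree theorem
  `Literature.AlgebraicGeometry.HodgeTheory.mem_algebraicClasses_middle_of_affineComplSections`.
* `ampleAdicLefschetz_sectionalSource_of_hodgeMiddle` — conversely middle-degree HC ⇒ SS: for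
  `p ≤ 1 ∨ n ≤ 4` the landed calibration `stub_lowDegree` fed with the landed Bertini supply
  `stub_supply`; for `p ≥ 2` cut `X` by `n − 2p` hyperplane sections of one embedding to a smooth
  `Y` of dimension exactly `2p` with `≤ n − 2p` ambient basic affine complement pieces (the landed
  `stub_iteratedSupply`), on which `f^* c` is a rational `(p,p)`-class in the MIDDLE degree.
* `ampleAdicLefschetz_sectionalSource_iff_hodgeMiddle` / `…_two_le` — the characterisation, and its
  restriction to `p ≥ 2` (the cases `p ≤ 1` being `algebraicClasses_zero` and Lefschetz `(1,1)`,
  `lefschetzOneOne_rational_holds`); the right-hand side of `…_two_le` is VERBATIM the signature of the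
  one open stub `stub_hodgeMiddle` of the registered skeleton `Cruxes/SectionalSource/Lines/birth.lean`.
* `ampleAdicLefschetz_hodgeConjecture_of_sectionalSource` — **SS ALONE implies the Hodge
  conjecture** (the summit statement `_root_.HodgeConjecture`), by BFNP Lemma 48
  (`hodgeConjectureFor_of_middleDimension_holds`, unconditional in the tree) applied to the middle
  degree supplied by SS; no `ThickDescent`, no weak/hard Lefschetz item of the route is used.
* `ampleAdicLefschetz_sectionalSource_iff_hodgeConjecture` — hence **`SectionalSource ↔
  HodgeConjecture`**, and `ampleAdicLefschetz_stubHodgeMiddle_iff_hodgeConjecture` — the open stub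
  `stub_hodgeMiddle` (middle-degree HC, `p ≥ 2`) is itself equivalent to the summit.
* `ampleAdicLefschetz_not_sectionalSource_of_middle_counterexample` — kill criterion: one
  non-algebraic middle-degree Hodge class refutes SS.

Reading for the route: the deciding theorem `closes : ThickDescent → SectionalSource →
WeakLefschetzInjective → HardLefschetzReduction → MiddleStabilisation → HodgeModelsExist →
HodgeConjecture` of the route file holds with every hypothesis but `SectionalSource` idle
(`ampleAdicLefschetz_closes_of_sectionalSource_only`); the crux carries the whole summit.

## References

* P. Deligne, *The Hodge conjecture*, Clay Mathematics Institute (2000), §1. [Deligne2000]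
* P. Brosnan, H. Fang, Z. Nie, G. Pearlstein, *Singularities of admissible normal functions*,
  Invent. Math. 177 (2009), §6 Lemma 48. [BrosnanFangNiePearlstein2009]
* C. Voisin, *Hodge Theory and Complex Algebraic Geometry I* (2002), §7.3.2 Rem. 7.29, Thm. 11.30. [VoisinHodgeI2002]
* C. Voisin, *Hodge Theory and Complex Algebraic Geometry II* (2003), Thm. 1.23, §2.1.1. [VoisinHodgeII2003]
* R. Hartshorne, *Algebraic Geometry* (1977), II Prop. 2.5, II Thm. 8.18. [Hartshorne1977]
-/

noncomputable section

-- `Summit.HodgeConjecture.HodgeConjecture.Theorems` is the mandated namespace (single-problem summit: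
-- Problem = Summit), which `linter.dupNamespace` flags on every declaration; the lakefile turns the
-- linter off tree-wide (weak option), restated here so stand-alone elaboration is warning-free too.
set_option linter.dupNamespace false

open CategoryTheory AlgebraicGeometry
open Literature.AlgebraicGeometry Literature.AlgebraicGeometry.Motives Literature.AlgebraicGeometry.HodgeTheory
open Summit.HodgeConjecture.HodgeConjecture.Theses.AmpleAdicLefschetz

namespace Summit.HodgeConjecture.HodgeConjecture.Theorems

/-! ## SS ⇒ middle-degree HC -/

/-- **SS alone implies the Hodge conjecture in the middle degree** (THICK-free): granted the crux
`SectionalSource`, every rational `(p,p)`-class on every smooth projective complex variety of dimension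
`2p` is algebraic — the tree theorem `mem_algebraicClasses_middle_of_affineComplSections` (product with
`ℙ¹`, dominance of one-affine-complement sections, degree trick) fed with SS at the slice
`(n, p) = (2p + 1, p)`. [cite: VoisinHodgeI2002, §7.3.2 Remark 7.29] [cite: Deligne2000, §1] -/
theorem ampleAdicLefschetz_hodgeMiddle_of_sectionalSource (hSS : SectionalSource) ⦃p : ℕ⦄
    ⦃X₀ : SchemeOver ℂ⦄ (hX₀ : IsSmoothProjective (2 * p) X₀) (c₀ : complexBetti X₀ (2 * p))
    (hc : IsRationalClass c₀) (hh : IsOfHodgeType (2 * p) X₀ (2 * p) p p c₀) :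
    c₀ ∈ algebraicClasses X₀ p :=
  mem_algebraicClasses_middle_of_affineComplSections (fun _ hX c hc' hh' => hSS hX le_rfl c hc' hh')
    hX₀ c₀ hc hh

/-- **Kill-criterion form**: a single rational `(p,p)`-class on a smooth projective `2p`-fold that is
NOT algebraic (a counterexample to the Hodge conjecture in the middle degree) refutes the crux
`SectionalSource` outright — no `ThickDescent` involved. [cite: Deligne2000, §1] -/
theorem ampleAdicLefschetz_not_sectionalSource_of_middle_counterexample
    (h : ∃ (p : ℕ) (X₀ : SchemeOver ℂ) (c₀ : complexBetti X₀ (2 * p)), IsSmoothProjective (2 * p) X₀ ∧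
      IsRationalClass c₀ ∧ IsOfHodgeType (2 * p) X₀ (2 * p) p p c₀ ∧ c₀ ∉ algebraicClasses X₀ p) :
    ¬ SectionalSource := by
  rintro hSS
  obtain ⟨p, X₀, c₀, hX₀, hc, hh, hnot⟩ := h
  exact hnot (ampleAdicLefschetz_hodgeMiddle_of_sectionalSource hSS hX₀ c₀ hc hh)

/-! ## Middle-degree HC ⇒ SS (the registered line's composition) -/

/-- **The Hodge conjecture in the middle degree implies the crux `SectionalSource`** (THICK-free):
for `p ≤ 1 ∨ n ≤ 4` by the landed calibration `stub_lowDegree` fed with the landed `stub_supply`; for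
`p ≥ 2`, cut the `n`-fold `X` by `k = n − 2p` hyperplane sections of one projective embedding to a
smooth projective `Y` of dimension exactly `2p` whose non-empty complement is covered by `≤ k` affine
(ambient basic) opens — the landed `stub_iteratedSupply` — so that `2p + |s| ≤ n`; the class `f^* c`
is rational (`IsRationalClass.map`) and of Hodge type `(p,p)` on `Y` (`IsOfHodgeType.map_of_le`,
`2p ≤ n`, a Hodge model of `Y` by `nonempty_hodgeModel_holds`), a class in the MIDDLE degree of `Y`,
hence algebraic by the hypothesis. [cite: Deligne2000, §1] [cite: VoisinHodgeI2002, §7.3.2]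
[cite: Hartshorne1977, II Thm. 8.18 and II Prop. 2.5] -/
theorem ampleAdicLefschetz_sectionalSource_of_hodgeMiddle
    (hMid : ∀ ⦃p : ℕ⦄ ⦃X₀ : SchemeOver ℂ⦄, IsSmoothProjective (2 * p) X₀ →
      ∀ c₀ : complexBetti X₀ (2 * p), IsRationalClass c₀ → IsOfHodgeType (2 * p) X₀ (2 * p) p p c₀ →
        c₀ ∈ algebraicClasses X₀ p) :
    SectionalSource := by
  intro n p X hX hp c hc hh
  by_cases hlow : p ≤ 1 ∨ n ≤ 4
  · exact stub_lowDegree stub_supply hX hp hlow c hc hh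
  · obtain ⟨Y, f, s, hY, hf, hs, hcov, hcard, hne⟩ :=
      stub_iteratedSupply hX (show 1 ≤ n - 2 * p by omega) (show n - 2 * p + 1 ≤ n by omega)
    have hdim : n - (n - 2 * p) = 2 * p := by omega
    rw [hdim] at hY
    haveI := hf
    refine ⟨2 * p, Y, f, s, hY, hf, hs, hcov, by omega, hne, ?_⟩
    obtain ⟨B⟩ := (nonempty_hodgeModel_holds (n := 2 * p) (X := Y)) hY
    have hrat : IsRationalClass (complexBetti.map f (2 * p) c) :=
      hc.map (AlgPoints.mapContinuous (L := ℂ) f)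
    have hhdg : IsOfHodgeType (2 * p) Y (2 * p) p p (complexBetti.map f (2 * p) c) :=
      hh.map_of_le hY hX B f (by omega)
    exact hMid hY _ hrat hhdg

/-! ## The characterisation by the middle degree -/

/-- **`SectionalSource` ⟺ the Hodge conjecture in the middle degree**: the crux is EQUIVALENT to
"every rational `(p,p)`-class on every smooth projective complex variety of dimension `2p` is
algebraic". Unconditional, `ThickDescent`-free. [cite: Deligne2000, §1]
[cite: VoisinHodgeI2002, §7.3.2 Remark 7.29] -/
theorem ampleAdicLefschetz_sectionalSource_iff_hodgeMiddle :
    SectionalSource ↔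
      ∀ ⦃p : ℕ⦄ ⦃X₀ : SchemeOver ℂ⦄, IsSmoothProjective (2 * p) X₀ →
        ∀ c₀ : complexBetti X₀ (2 * p), IsRationalClass c₀ → IsOfHodgeType (2 * p) X₀ (2 * p) p p c₀ →
          c₀ ∈ algebraicClasses X₀ p :=
  ⟨fun h _ _ hX₀ c₀ hc hh => ampleAdicLefschetz_hodgeMiddle_of_sectionalSource h hX₀ c₀ hc hh,
    ampleAdicLefschetz_sectionalSource_of_hodgeMiddle⟩

/-- **The cases `p ≤ 1` of middle-degree HC are theorems** (`p = 0`: `algebraicClasses_zero`;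
`p = 1`: Lefschetz `(1,1)` on surfaces, `lefschetzOneOne_rational_holds`), so the crux is equivalent
to middle-degree HC for `p ≥ 2` — VERBATIM the signature of the open stub `stub_hodgeMiddle` of the
registered skeleton, whose first instance is HC for fourfolds in degree 4.
[cite: VoisinHodgeI2002, Thm. 11.30] [cite: Deligne2000, §1] -/
theorem ampleAdicLefschetz_sectionalSource_iff_hodgeMiddle_two_le :
    SectionalSource ↔
      ∀ ⦃p : ℕ⦄ ⦃X₀ : Literature.AlgebraicGeometry.Motives.SchemeOver ℂ⦄,
        Literature.AlgebraicGeometry.Motives.IsSmoothProjective (2 * p) X₀ → 2 ≤ p →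
        ∀ c₀ : Literature.AlgebraicGeometry.HodgeTheory.complexBetti X₀ (2 * p),
          Literature.AlgebraicGeometry.HodgeTheory.IsRationalClass c₀ →
          Literature.AlgebraicGeometry.HodgeTheory.IsOfHodgeType (2 * p) X₀ (2 * p) p p c₀ →
          c₀ ∈ Literature.AlgebraicGeometry.HodgeTheory.algebraicClasses X₀ p := by
  refine ⟨fun h _ _ hX₀ _ c₀ hc hh => ampleAdicLefschetz_hodgeMiddle_of_sectionalSource h hX₀ c₀ hc hh,
    fun hMid => ?_⟩
  refine ampleAdicLefschetz_sectionalSource_of_hodgeMiddle fun p X₀ hX₀ c₀ hc hh => ?_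
  rcases Nat.lt_or_ge p 2 with hp | hp
  · interval_cases p
    · rw [algebraicClasses_zero]
      trivial
    · exact lefschetzOneOne_rational_holds hX₀ _ hc hh
  · exact hMid hX₀ hp c₀ hc hh

/-! ## The characterisation by the summit -/

/-- **`SectionalSource` ALONE implies the Hodge conjecture** (the summit statement), with no
`ThickDescent` and no weak/hard Lefschetz item: SS gives the Hodge conjecture in every middle degree
(`ampleAdicLefschetz_hodgeMiddle_of_sectionalSource`), and BFNP Lemma 48 — the tree theorem
`hodgeConjectureFor_of_middleDimension_holds` (products with projective spaces below the middle,
linear sections and weak Lefschetz above it; Hodge models by `nonempty_hodgeModel_holds`) — gives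
`HodgeConjectureFor n X` for every smooth projective `X`. [cite: BrosnanFangNiePearlstein2009, §6 Lemma 48]
[cite: Deligne2000, §1] -/
theorem ampleAdicLefschetz_hodgeConjecture_of_sectionalSource (hSS : SectionalSource) :
    _root_.HodgeConjecture :=
  fun _ _ hX => hodgeConjectureFor_of_middleDimension_holds
    (fun _ _ hX₀ c₀ hc hh => ampleAdicLefschetz_hodgeMiddle_of_sectionalSource hSS hX₀ c₀ hc hh) hX

/-- **The Hodge conjecture implies `SectionalSource`** (specialise HC to the middle degree and run the
registered line's composition `ampleAdicLefschetz_sectionalSource_of_hodgeMiddle`).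
[cite: Deligne2000, §1] -/
theorem ampleAdicLefschetz_sectionalSource_of_hodgeConjecture (hHC : _root_.HodgeConjecture) :
    SectionalSource :=
  ampleAdicLefschetz_sectionalSource_of_hodgeMiddle fun p _ hX₀ c₀ hc hh => (hHC hX₀).2 p c₀ hc hh

/-- **`SectionalSource ↔ HodgeConjecture`**: the crux #3 of the route `AmpleAdicLefschetz` is
EQUIVALENT to the summit statement. Unconditional, sorry-free; the forward direction uses no other
item of the route. [cite: Deligne2000, §1] [cite: BrosnanFangNiePearlstein2009, §6 Lemma 48] -/
theorem ampleAdicLefschetz_sectionalSource_iff_hodgeConjecture :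
    Summit.HodgeConjecture.HodgeConjecture.Theses.AmpleAdicLefschetz.SectionalSource ↔ _root_.HodgeConjecture :=
  ⟨ampleAdicLefschetz_hodgeConjecture_of_sectionalSource,
    ampleAdicLefschetz_sectionalSource_of_hodgeConjecture⟩

/-- **The open stub `stub_hodgeMiddle` is equivalent to the Hodge conjecture**: middle-degree HC for
`p ≥ 2` (VERBATIM the registered stub signature of `Cruxes/SectionalSource/Lines/birth.lean`) ⟺
`_root_.HodgeConjecture` — by the two characterisations of `SectionalSource`. So the one `sorry` left
in the registered skeleton is summit-sized, not merely crux-sized.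
[cite: BrosnanFangNiePearlstein2009, §6 Lemma 48] [cite: VoisinHodgeI2002, Thm. 11.30] -/
theorem ampleAdicLefschetz_stubHodgeMiddle_iff_hodgeConjecture :
    (∀ ⦃p : ℕ⦄ ⦃X₀ : Literature.AlgebraicGeometry.Motives.SchemeOver ℂ⦄,
        Literature.AlgebraicGeometry.Motives.IsSmoothProjective (2 * p) X₀ → 2 ≤ p →
        ∀ c₀ : Literature.AlgebraicGeometry.HodgeTheory.complexBetti X₀ (2 * p),
          Literature.AlgebraicGeometry.HodgeTheory.IsRationalClass c₀ →
          Literature.AlgebraicGeometry.HodgeTheory.IsOfHodgeType (2 * p) X₀ (2 * p) p p c₀ →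
          c₀ ∈ Literature.AlgebraicGeometry.HodgeTheory.algebraicClasses X₀ p) ↔
      _root_.HodgeConjecture :=
  ampleAdicLefschetz_sectionalSource_iff_hodgeMiddle_two_le.symm.trans
    ampleAdicLefschetz_sectionalSource_iff_hodgeConjecture

/-- **SS implies the Hodge conjecture for `(2,2)`-classes on every smooth projective FOURFOLD** — the
first open case of the Hodge conjecture (`p = 2` in `ampleAdicLefschetz_hodgeMiddle_of_sectionalSource`).
[cite: Deligne2000, §1] [cite: VoisinHodgeI2002, §7.3.2 Remark 7.29] -/
theorem ampleAdicLefschetz_hodge_fourfold_of_sectionalSource (hSS : SectionalSource) ⦃X : SchemeOver ℂ⦄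
    (hX : IsSmoothProjective 4 X) (c : complexBetti X 4) (hc : IsRationalClass c)
    (hh : IsOfHodgeType 4 X 4 2 2 c) : c ∈ algebraicClasses X 2 :=
  ampleAdicLefschetz_hodgeMiddle_of_sectionalSource hSS (p := 2) hX c hc hh

/-! ## Consequence for the route's deciding theorem -/

/-- **In the route's deciding theorem every hypothesis but `SectionalSource` is idle**: the
conclusion `_root_.HodgeConjecture` of `Theses.AmpleAdicLefschetz.closes` already follows from its
second hypothesis alone (`ampleAdicLefschetz_hodgeConjecture_of_sectionalSource`); stated with the
same binder list as `closes` so that the comparison is literal. [cite: BrosnanFangNiePearlstein2009, §6 Lemma 48] -/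
theorem ampleAdicLefschetz_closes_of_sectionalSource_only (_hT : ThickDescent) (hS : SectionalSource)
    (_hW : WeakLefschetzInjective) (_hH : HardLefschetzReduction) (_hMid : MiddleStabilisation)
    (_hM : HodgeModelsExist) : _root_.HodgeConjecture :=
  ampleAdicLefschetz_hodgeConjecture_of_sectionalSource hS

/-- **`Target ↔ ThickDescent ∧ HodgeConjecture`**: the route's target `X = THICK ∧ SS` is THICK
together with the summit itself (`Target ↔ ThickDescent ∧ SectionalSource` is `Iff.rfl`).
[cite: Deligne2000, §1] -/
theorem ampleAdicLefschetz_target_iff_thickDescent_and_hodgeConjecture :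
    Target ↔ ThickDescent ∧ _root_.HodgeConjecture :=
  Iff.and Iff.rfl ampleAdicLefschetz_sectionalSource_iff_hodgeConjecture

/-! ## The crux and the summit from the one open stub (appended, lead c1 cycle 1) -/

/-- **The crux from its one open registered stub**: middle-degree HC for `p ≥ 2` (VERBATIM the
signature of `stub_hodgeMiddle` in `Cruxes/SectionalSource/Lines/birth.lean`) implies `SectionalSource` —
the registered skeleton's composition with the three landed stubs plugged in, importable: whoever proves
the stub closes the crux in one line. [cite: Deligne2000, §1] [cite: VoisinHodgeI2002, Thm. 11.30] -/
theorem ampleAdicLefschetz_sectionalSource_of_stubHodgeMiddle :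
    (∀ ⦃p : ℕ⦄ ⦃X₀ : Literature.AlgebraicGeometry.Motives.SchemeOver ℂ⦄, Literature.AlgebraicGeometry.Motives.IsSmoothProjective (2 * p) X₀ → 2 ≤ p → ∀ c₀ : Literature.AlgebraicGeometry.HodgeTheory.complexBetti X₀ (2 * p), Literature.AlgebraicGeometry.HodgeTheory.IsRationalClass c₀ → Literature.AlgebraicGeometry.HodgeTheory.IsOfHodgeType (2 * p) X₀ (2 * p) p p c₀ → c₀ ∈ Literature.AlgebraicGeometry.HodgeTheory.algebraicClasses X₀ p) → Summit.HodgeConjecture.HodgeConjecture.Theses.AmpleAdicLefschetz.SectionalSource :=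
  fun hStub => ampleAdicLefschetz_sectionalSource_iff_hodgeMiddle_two_le.2 hStub

/-- **The summit from the one open registered stub**: middle-degree HC for `p ≥ 2` implies
`_root_.HodgeConjecture` (BFNP Lemma 48 with the free bidegrees `(0,0)` and `(2,1)`).
[cite: BrosnanFangNiePearlstein2009, §6 Lemma 48] [cite: VoisinHodgeI2002, Thm. 11.30] -/
theorem ampleAdicLefschetz_hodgeConjecture_of_stubHodgeMiddle
    (hStub : ∀ ⦃p : ℕ⦄ ⦃X₀ : Literature.AlgebraicGeometry.Motives.SchemeOver ℂ⦄,
        Literature.AlgebraicGeometry.Motives.IsSmoothProjective (2 * p) X₀ → 2 ≤ p →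
        ∀ c₀ : Literature.AlgebraicGeometry.HodgeTheory.complexBetti X₀ (2 * p),
          Literature.AlgebraicGeometry.HodgeTheory.IsRationalClass c₀ →
          Literature.AlgebraicGeometry.HodgeTheory.IsOfHodgeType (2 * p) X₀ (2 * p) p p c₀ →
          c₀ ∈ Literature.AlgebraicGeometry.HodgeTheory.algebraicClasses X₀ p) :
    _root_.HodgeConjecture :=
  ampleAdicLefschetz_stubHodgeMiddle_iff_hodgeConjecture.1 hStub

/-- **The one open registered stub from the summit** (specialisation). [cite: Deligne2000, §1] -/
theorem ampleAdicLefschetz_stubHodgeMiddle_of_hodgeConjecture (hHC : _root_.HodgeConjecture) :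
    ∀ ⦃p : ℕ⦄ ⦃X₀ : Literature.AlgebraicGeometry.Motives.SchemeOver ℂ⦄,
        Literature.AlgebraicGeometry.Motives.IsSmoothProjective (2 * p) X₀ → 2 ≤ p →
        ∀ c₀ : Literature.AlgebraicGeometry.HodgeTheory.complexBetti X₀ (2 * p),
          Literature.AlgebraicGeometry.HodgeTheory.IsRationalClass c₀ →
          Literature.AlgebraicGeometry.HodgeTheory.IsOfHodgeType (2 * p) X₀ (2 * p) p p c₀ →
          c₀ ∈ Literature.AlgebraicGeometry.HodgeTheory.algebraicClasses X₀ p :=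
  ampleAdicLefschetz_stubHodgeMiddle_iff_hodgeConjecture.2 hHC

end Summit.HodgeConjecture.HodgeConjecture.Theorems

end
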